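import Literature.MathematicalPhysics.QuantumFieldTheory.Balaban1983to89.T4CanonicalMenus
import Literature.MathematicalPhysics.QuantumFieldTheory.Balaban1983to89.T4OverdueHorizon

/-!
# `Balaban1983to89.T4CountHorizon` — the COUNT member's records budget of node U5c (spine estimate NE7b, member P1
«Peierls / entropy–energy counting of persistent large-field histories») under the CELL's level schedule [CONV-D] of
RULING R-ηW: the pending clause of the labelling binder weakens from `K < reach` to `K − D < reach` (`D = N_W + 1`
youngest levels without a complete ℝ), and the whole count chain — generic bridge, tagged seam, end to end over the
canonical menus — survives with ONE explicit deficit factor `exp(κ₁·D)` absorbed into the ROOT WEIGHT of every branching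
record, hence into the birth mass `ρ̄ ↦ Δ·e^{κ₁ D}·ρ̄` of `recordsBudget`, with the K-free smallness threshold of the
weight DISPLAYED — located obligation **O-ηW-β** in discharge form (ii) («EXPLICIT DEFICIT») in the COUNT currency, and
the declaration **O-ηW-δ** for the count lineage's leaves (cell `pub-balaban`, T4-DAG v26 §8 Q24(a) self-row
T4-U5c.E-NE7b-COUNT-HORIZON-K*, node U5c / U5.E, generation 16; record `t4/T4-EST-NE7b-P1.md` v1.16; the numerator-side
twin of `T4OverdueHorizon` (renewal member P2, v1 p194117), which hands this half over in its header and in the journal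
NOTE post-rotation l.778; kernel bookkeeping over `T4CanonicalMenus` (this lineage, v1 p194023) and `T4OverdueHorizon`
(lineage t4-ne7b-p2) imported BY NAME; additive leaf, no sibling module modified.  VERSION v1 = this file.)

HONEST FRAMING (T4-DAG PAGE 1).  The cell's T4 target is the existence and uniqueness of the `ε → 0` limit of unit-scale
block-averaged expectations on a FIXED finite torus, at rung (B)+1, CONDITIONAL on Bałaban's ultraviolet stability (B)
and on BetaPertH; it is NOT infinite volume, NOT the mass gap, NOT the Clay problem.  This module is [folklore] real
arithmetic and the lineage's own bridge / seam / end-to-end theorems re-instantiated at a shifted cutoff.  NOTHING of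
Bałaban's is asserted, no printed sentence is used as a hypothesis, no `def … : Prop` fact is minted, nothing is quoted.
THE SCHEDULE IS THE CELL'S, NOT PRINT'S (R-ηW-7): print heals every eligible component at every level; the η-design's runs
A (cutoff `K`) and B (cutoff `K + 1`) are «print-literal except: no complete ℝ at the N_W + 1 youngest levels of either
run (cell convention R-ηW)» (`t4/T4-REF-U5.md` v1.4.19 §19, ruling R-ηW-1; GAPS G-pv06g25-2).  A docstring below that
says «under [CONV-D]» speaks of that cell convention and of nothing in the papers.  (B), BetaPertH, (B^μ), the reading
(ID), the geometric multiplicity (GM), the caps and the flow instantiation stay exactly where `T4CanonicalMenus` left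
them: displayed binders, hidden in no definition.

THE RULING'S QUESTION TO THIS LINEAGE (R-ηW-4 (β), obligation O-ηW-β; verbatim core as transcribed in GAPS G-pv06g25-2 and
in the header of `T4OverdueHorizon`): «idem for the young relative weights and the Bad budget — and since `hlt` needs
W_K + Σ_a n(a)·lipWeight·ρ(a) < 1, "absorbed K-freely" is NOT enough: W_K must stay SMALL and K-free with the overdue
population of G-ne7cp2-9 counted»; discharge «either (i) SCHEDULE-FREE — name the hypothesis list the bound uses and
observe none refers to the healing schedule; or (ii) EXPLICIT DEFICIT — a factor ≤ exp(c₁·(N_W + 1)·Σ_i w(X_i)) over the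
overdue components X_i, with c₁ K-free and w print's per-component size weight at the component's scale, absorbed into
the supplier's constant with the absorption shown K-free».  O-ηW-δ: every window-level reader declares whether a B15 §1 /
B16 §1 inductive hypothesis assuming healing-when-eligible is invoked.

DECLARATION O-ηW-δ FOR THE COUNT LINEAGE (form (i), BY TYPE; the thirteen accepted leaves `T4PersistentHistoryCount`,
`T4PersistenceDictionary`, `T4EntropyShapeInstances`, `T4BadClassBooking`, `T4RecordChains`, `T4LiveStructureGas`,
`T4BankedInduction`, `T4PrintedShapeBanking`, `T4RecordPriceSeam`, `T4PartnerMultiplicity`, `T4BranchingRecordsGas`,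
`T4TaggedShapeBanking`, `T4CanonicalMenus`).  NO theorem of the lineage invokes a B15 §1 / B16 §1 inductive hypothesis,
and no hypothesis list contains one.  The healing schedule enters the count chain at EXACTLY ONE PLACE, always as a
DISPLAYED HYPOTHESIS handed to the (ID) owner and never discharged by this lineage: the MODEL OF PRINT'S PROCEDURE in
which a pending structure's events are chained at readiness — `T4PersistenceDictionary.Gen.reach` (rules (L1)–(L3) of
B16 pp. 384–387 booked as an exclusive horizon), `Gen.WF` (renewal while pending, merger partners alive together), the
consistency predicates `T4PrintedShapeBanking.Consistent` / `T4TaggedShapeBanking.ConsistentT` (renewal AT READINESS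
`h + 1 = reach`, merger step `<` both partners' reaches), and the PENDING CLAUSE `K < reach` of the cover theorem
`Gen.covers` / `spanLE` / `mem_records`, of `T4PartnerMultiplicity.span_add_windowSurplus_le`, of the bridge
`T4BranchingRecordsGas.treeShape_of_mulRawShape` and of the labelling binders `hlab` / `hlabB` / `hlabT` of every seam
and end-to-end statement (`…exists_irThreshold_relWeightBound_canon` included).  Everything else is schedule-free by
type: the history / record / shape counts (`T4PersistentHistoryCount`, `T4EntropyShapeInstances`), the class booking
(`T4BadClassBooking`), the live structure gas and `recordsBudget` (`T4LiveStructureGas`), the menus, `fam`, the four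
budgets, the age factor, the root rate `Λ·e^{η̄₊ − κ₁} < 1`, the cells, the slots, the two `Regeneration` runs
(`T4BranchingRecordsGas`, `T4CanonicalMenus`), and the BANKING of the printed flow inequalities
(`T4PrintedShapeBanking.banking_…`, `T4TaggedShapeBanking.exists_irThresholdT`: typed (2.7) / (2.9) / (2.5) along a run
⇒ `Banking`, which prices an event WHEN IT IS BOOKED and reads no schedule).  Under print's schedule the (ID) owner
exhibits, per priced slot, a consistent well-formed genealogy PENDING AT THE CUTOFF, `K < reach`; under [CONV-D] the
same owner can only be asked for `K − D < reach` (below), and THAT is where the deficit is paid — in this module.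

THE ANSWER, IN COUNT CURRENCY (what is typed below; the READING is the cell's, the ARITHMETIC is the kernel's).
WHERE THE DEFICIT COMES FROM.  Under [CONV-D] the complete ℝ of run A is performed at the steps `x ≤ K − D` only
(R-ηW-5, reading [T-a]: the last performed ℝ sits at age `N_W + 1 =: D`).  A structure whose horizon falls in the window,
`K − D < reach ≤ K`, is NOT healed (no ℝ acts there) and carries NO event there (a renewal (L2) happens in the
preparatory operations OF a performed ℝ): it is un-healed at the cutoff with a genealogy that is consistent and well
formed but only `K − D < reach` — exactly the OVERDUE POPULATION of G-ne7cp2-9 («old structures eligible at a window age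
and left un-healed»).  Its COUNT is unchanged: it is a structure pending at the cutoff, its shape is a branching record of
the canonical run (`T4CanonicalMenus` §4), its cell is one of the `V·Λ^{age}` cells — no new population, no new entropy.
Its PRICE is weaker: the window credits telescope only over `[j, K − D]` (`span_add_windowSurplus_le` at the cutoff
`K − D`), so the telescoped tree shape `e^{−κ₁ (K + 1 − j)}·treeWt` of the bridge holds with the ONE factor `e^{κ₁ D}`
(`K + 1 − j ≤ (K − D + 1 − j) + D`, truncated subtraction included): **`treeShape_of_mulRawShape_horizon`** (§2).  In the
ruling's letters: deficit `exp(c₁·(N_W + 1))` per pending structure with `c₁ = κ₁` = the per-step window credit of the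
count (`T4PrintedShapeBanking.Consts.κ₁`, a symbolic K-free constant), `≤ exp(c₁·(N_W + 1)·w(X))` for any size weight
`w(X) ≥ 1` (`T4OverdueHorizon.exp_mul_le_exp_mul_mul`) — form (ii).
THE ABSORPTION, SHOWN K-FREE.  `treeWt ρ η θ st G = ρ(root)·θ^{partnerAges}·npNR η G` is LINEAR in the root weight, so
the factor is absorbed as `ρ ↦ rhoH Ξ := Ξ·rho` with `Ξ = Δ·e^{κ₁ D}` (`Δ ≥ 1` a displayed K-free PRICE-SIDE ALLOWANCE
for the (ID) owner, `Δ = 1` if unused): the tagged seam **`treeShape_of_labelBT_horizon`** /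
**`treeShape_of_labelT_horizon`** (§3) and, end to end, **`exists_relWeightBound_of_bankingT_horizon`** /
**`exists_irThreshold_relWeightBound_canon_horizon`** (§4) = `T4TaggedShapeBanking.exists_relWeightBound_of_bankingT` /
`T4CanonicalMenus.exists_irThreshold_relWeightBound_canon` with the labelling binder's pending clause `K − D < reach`
and allowance `Δ`, and the conclusion's budget `recordsBudget (Δ·e^{C.κ₁ D}·birthMass C) C.κ₁ V Λ η̄₊ j⋆` — the root
budget `ρ̄` scaled, NOTHING ELSE TOUCHED: the menus' budgets `a = μ = e^{−E₀}`, `ν = birthMass C`, the fixed-point side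
condition, the age rate `Λ′e^{−κ₁}e^{η̄₊} < 1`, and the CONDITION of the node — the root rate `Λ·e^{η̄₊ − κ₁} < 1`, i.e.
the geometric rate of `recordsBudget` in `K` — are VERBATIM those of `_canon`.  NO NEW DEPENDENCE ON K IS INTRODUCED.
SMALL AND K-FREE, WITH THE NUMBER (§5; the ruling's «absorbed K-freely is NOT enough»).  `recordsBudget (Ξρ̄) = Ξ·
exp((Ξ − 1)·m)·recordsBudget ρ̄` with the live mass `m = ρ̄e^{−κ₁}V/(1 − r)`, `r = Λe^{η̄₊ − κ₁}`
(**`recordsBudget_const_mul`**: the deficit is a K-FREE CONSTANT FACTOR on the budget); with the old fraction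
`c·K ≤ K − j⋆(K)` the budget is `≤ M·ϱ^K`, `M = ρ̄e^{−κ₁}V·r/(1 − r)·e^{m}`, `ϱ = r^c` (**`recordsBudget_le_geometric`**,
via `T4OverdueHorizon.twoRateBudget_le_geometric` by name), hence **`recordsWeight_lt`**: `Cn·recordsBudget ρ̄ … K < ε`
for EVERY `K` with `log(Cn·M/ε) < K·log ϱ⁻¹` (`T4OverdueHorizon.mul_pow_lt_of_log_lt` by name) — at the deficited mass
`Ξρ̄` the left side moves by `log Ξ + (Ξ − 1)·m = log Δ + κ₁D + (Δe^{κ₁D} − 1)·m` (**`log_horizonConst`**) and by nothing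
depending on `K`.  Run B (cutoff `K + 1`) has the same `D` relative to ITS cutoff; the pair-indexed common budget absorbs
the one-step offset into `Cn` as before.
RESIDUAL, LOCATED — NOT HIDDEN (for the (ID) owner and generation 17; GAPS row of this generation).  (H1) LATE MERGERS
WITH AN OVERDUE PARTNER: under [CONV-D] an un-healed overdue structure `X` (`K − D < reach X ≤ t`) may still be joined
into a merger at a step `t ≤ K` (births and mergers are events of the T-steps, which are performed at every level); such a
genealogy violates the merger clause `t < reach X` of `ConsistentT` (and possibly `Gen.WF`'s overlap clause) and is NOT
covered by the theorems below — its cover has a gap inside `(K − D, K]`, harmless for the credit telescope on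
`[j, K − D]` but outside the typed consistency predicate; typing it = a cutoff-aware merger clause `t < max (reach X)
(K − D + 1)` with the cover theorem on `[rootStep, K − D]` (a leaf over `T4PersistenceDictionary`), then this module's
seam verbatim.  (H2) UN-BOOKED OVERDUE FLOORS: an overdue constituent keeps costing `floorK = E₂·R_n^{q′}` per step for
`< D` steps beyond its window, a cost `Banking` does not book; per constituent `≤ (D/R_n)`× its own window bank
`E₂R_n^{q′}·W` (`W ≥ R_n + 1`), absorbed on the banking side by raising the infrared threshold `x₀` (so that `R_K ≥ …·D`)
— K-free as a threshold on `log g_K⁻²`; or displayed through the allowance `Δ` per slot when the (ID) owner bounds the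
number of overdue constituents per structure.  Neither (H1) nor (H2) is asserted or assumed anywhere below.

WHAT IS PROVED (0 `sorry`; all [folklore]).
§1 `span_le_horizonSpan_add`, `exp_horizonSpan_le` (the horizon credit inequality), `rhoH` (the deficited root weight)
   with `rhoH_apply`, `rhoH_one`, `rhoH_pos`, `rhoH_shape`, `sum_rhoH`, `treeWt_rhoH`, `treeWt_rhoH_comp`,
   `treeWt_relabel_shapeH`.
§2 **`treeShape_of_mulRawShape_horizon`** (generic bridge, pending clause `K − D < reach`, deficit `e^{κ₁ D}` on the root).
§3 **`treeShape_of_labelBT_horizon`**, **`treeShape_of_labelT_horizon`** (tagged seam with horizon and allowance `Δ`).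
§4 **`exists_relWeightBound_of_bankingT_horizon`**, **`exists_irThreshold_relWeightBound_canon_horizon`**.
§5 `recordsBudget_const_mul`, `recordsBudget_le_geometric`, `recordsWeight_lt`, `log_horizonConst`.
§6 sanity: `D = 0`, `Δ = 1` is `_canon`'s root weight and budget verbatim (`rhoH_canon`, `horizonMass_zero`); a decided
   deficit (`κ₁ = log 2`, `D = 3` ⇒ factor `8`).
Deliberately NOT here: (H1), (H2); the value of `N_W` (pv07's η-design) and the cap `N_W ≤ N₀`; the instantiation of the
binders ((ID) G-ne7bp1g9-1, (GM) G-ne7bp1g12-1, caps, cells, flow); node U5b's O-ηW-α; the renewal currency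
(`T4OverdueHorizon`).  Value = a located obligation made checkable + kernel bookkeeping; NOT an estimate of Bałaban's,
NOT summit progress.
-/

open Finset

namespace Literature.MathematicalPhysics.QuantumFieldTheory.Balaban1983to89

namespace T4CountHorizon

open T4PersistenceDictionary T4PersistentHistoryCount T4BankedInduction T4PrintedShapeBanking
open T4WeightBudget T4GlobalDenominator T4LiveClassFibration T4LiveStructureGas T4LiveGasToTerms T4RecordPriceSeam
open T4PartnerMultiplicity T4BranchingRecordsGas T4TaggedShapeBanking T4CanonicalMenus

noncomputable section

/-! ## §1 Arithmetic of the horizon and the deficited root weight -/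

section Arithmetic

/-- ℕ: the pending span at cutoff `K` exceeds the span at cutoff `K − D` by at most `D` (truncated subtraction
throughout). [folklore] -/
theorem span_le_horizonSpan_add (K D s : ℕ) : K + 1 - s ≤ (K - D + 1 - s) + D := by
  omega

/-- **THE HORIZON CREDIT INEQUALITY**: `e^{−κ₁ (K − D + 1 − s)} ≤ e^{κ₁ D}·e^{−κ₁ (K + 1 − s)}` for `κ₁ ≥ 0` — losing the
window credits of the `D` youngest levels costs at most the K-free factor `e^{κ₁ D}`. [folklore] -/
theorem exp_horizonSpan_le {κ₁ : ℝ} (hκ : 0 ≤ κ₁) (K D s : ℕ) :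
    Real.exp (-(κ₁ * ((K - D + 1 - s : ℕ) : ℝ))) ≤
      Real.exp (κ₁ * (D : ℝ)) * Real.exp (-(κ₁ * ((K + 1 - s : ℕ) : ℝ))) := by
  rw [← Real.exp_add, Real.exp_le_exp]
  have h : ((K + 1 - s : ℕ) : ℝ) ≤ ((K - D + 1 - s : ℕ) : ℝ) + (D : ℝ) := by
    exact_mod_cast span_le_horizonSpan_add K D s
  have h' := mul_le_mul_of_nonneg_left h hκ
  rw [mul_add] at h'
  linarith

/-- in the ruling's letters: `e^{κ₁ D} = (e^{−κ₁})⁻¹ ^ D` — the count's per-step window credit `e^{−κ₁}` plays the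
renewal currency's survival rate `σ` (`T4OverdueHorizon.inv_exp_neg_pow` by name). [folklore] -/
theorem exp_mul_eq_inv_pow (κ₁ : ℝ) (D : ℕ) : Real.exp (κ₁ * (D : ℝ)) = (Real.exp (-κ₁))⁻¹ ^ D := by
  rw [T4OverdueHorizon.inv_exp_neg_pow, mul_comm]

variable {δ : Type*}

/-- **THE DEFICITED ROOT WEIGHT** `rhoH Ξ C g b = Ξ·rho C g b`: the birth residual of the count's model scaled by the
horizon factor (and the price-side allowance) `Ξ = Δ·e^{κ₁ D}`. [folklore] -/
def rhoH (Ξ : ℝ) (C : T4PrintedShapeBanking.Consts) (g : ℕ → ℝ) (b : PEv) : ℝ := Ξ * rho C g b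

/-- the deficited root weight unfolded [folklore] -/
@[simp] theorem rhoH_apply (Ξ : ℝ) (C : T4PrintedShapeBanking.Consts) (g : ℕ → ℝ) (b : PEv) :
    rhoH Ξ C g b = Ξ * rho C g b := rfl

/-- no deficit: `rhoH 1 = rho` [folklore] -/
theorem rhoH_one (C : T4PrintedShapeBanking.Consts) (g : ℕ → ℝ) : rhoH 1 C g = rho C g := by
  funext b; simp

/-- the deficited root weight is nonnegative for `Ξ ≥ 0` [folklore] -/
theorem rhoH_nonneg {Ξ : ℝ} (hΞ : 0 ≤ Ξ) (C : T4PrintedShapeBanking.Consts) (g : ℕ → ℝ) (b : PEv) :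
    0 ≤ rhoH Ξ C g b :=
  mul_nonneg hΞ (rho_pos C g b).le

/-- the deficited root weight depends only on the shape [folklore] -/
@[simp] theorem rhoH_shape (Ξ : ℝ) (C : T4PrintedShapeBanking.Consts) (g : ℕ → ℝ) (e : PEv) :
    rhoH Ξ C g (shape e) = rhoH Ξ C g e := by
  simp [rhoH]

/-- a menu sum of the deficited weight is `Ξ` times the menu sum [folklore] -/
theorem sum_rhoH (Ξ : ℝ) (C : T4PrintedShapeBanking.Consts) (g : ℕ → ℝ) (s : Finset PEv) :
    ∑ b ∈ s, rhoH Ξ C g b = Ξ * ∑ b ∈ s, rho C g b := by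
  simp [rhoH, Finset.mul_sum]

/-- `treeWt` is LINEAR in the root weight: `treeWt (rhoH Ξ) = Ξ·treeWt rho`. [folklore] -/
theorem treeWt_rhoH (Ξ : ℝ) (C : T4PrintedShapeBanking.Consts) (g : ℕ → ℝ) (η : PEv → ℝ) (θ : ℝ) (st : PEv → ℕ)
    (G : Gen PEv) : treeWt (rhoH Ξ C g) η θ st G = Ξ * treeWt (rho C g) η θ st G := by
  simp only [treeWt, rhoH_apply]; ring

/-- … and through a shape map: `treeWt (rhoH Ξ ∘ sh) = Ξ·treeWt (rho ∘ sh)`. [folklore] -/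
theorem treeWt_rhoH_comp {ε : Type*} (Ξ : ℝ) (sh : ε → PEv) (C : T4PrintedShapeBanking.Consts) (g : ℕ → ℝ)
    (η : ε → ℝ) (θ : ℝ) (st : ε → ℕ) (G : Gen ε) :
    treeWt (rhoH Ξ C g ∘ sh) η θ st G = Ξ * treeWt (rho C g ∘ sh) η θ st G := by
  simp only [treeWt, Function.comp_apply, rhoH_apply]; ring

/-- a constant factor on a general root weight: `treeWt (c·ρ) = c·treeWt ρ`. [folklore] -/
theorem treeWt_const_mul (c : ℝ) (ρ η : δ → ℝ) (θ : ℝ) (st : δ → ℕ) (G : Gen δ) :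
    treeWt (fun b => c * ρ b) η θ st G = c * treeWt ρ η θ st G := by
  simp only [treeWt]; ring

/-- the deficited tree weight of the model is read off the shapes of the tags (`treeWt_relabel` + `rhoH_shape`,
`eta_shape`, `step_shape`). [folklore] -/
theorem treeWt_relabel_shapeH {ε : Type*} (Ξ : ℝ) (sh : ε → PEv) (C : T4PrintedShapeBanking.Consts) (g : ℕ → ℝ)
    (θ : ℝ) (G : Gen ε) :
    treeWt (rhoH Ξ C g) (eta C) θ PEv.step (relabel (shape ∘ sh) G) =
      treeWt (rhoH Ξ C g ∘ sh) (eta C ∘ sh) θ (PEv.step ∘ sh) G := by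
  rw [treeWt_relabel (shape ∘ sh) (rhoH Ξ C g) (eta C) θ (st := PEv.step ∘ sh) (st' := PEv.step)
    (fun e => step_shape (sh e))]
  simp only [Function.comp_def, rhoH_shape, eta_shape]

end Arithmetic

/-! ## §2 The generic bridge with horizon `D` -/

section Bridge

variable {ε : Type*} [DecidableEq ε]

/-- **THE GENERIC BRIDGE UNDER [CONV-D]** — `T4BranchingRecordsGas.treeShape_of_mulRawShape` with the pending clause
weakened to the horizon form `K − D < reach` (`D = N_W + 1` un-healed youngest levels): a well-formed genealogy `G` whose
partner ages are at most its window surplus and a price `y ≤ M^{partnerAges}·(raw shape)` obey the SAME telescoped tree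
shape at the cutoff `K`, with the root weight scaled by the ONE deficit factor `e^{κ₁ D}`:
`y ≤ e^{−κ₁ (K + 1 − rootStep G)}·treeWt (e^{κ₁ D}·ρ) η (M·e^{−κ₁}) st G`.  Proof: the bridge at the cutoff `K − D`, then
`exp_horizonSpan_le`. [folklore] -/
theorem treeShape_of_mulRawShape_horizon {W st : ε → ℕ} {ρ η : ε → ℝ} {κ₁ M : ℝ} (hκ : 0 ≤ κ₁) (hM : 0 ≤ M)
    {G : Gen ε} (hW : G.WF W) (hρ : 0 ≤ ρ G.root) (hη : ∀ e, 0 < η e) {K : ℕ} (D : ℕ) (hK : K - D < G.reach W)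
    (hsur : partnerAges st G ≤ windowSurplus W G) {y : ℝ}
    (hy : y ≤ M ^ partnerAges st G * (ρ G.root * Real.exp (-(κ₁ * W G.root)) *
      ∏ e ∈ G.events.erase G.root, (Real.exp (-(κ₁ * W e)) * η e))) :
    y ≤ Real.exp (-(κ₁ * ((K + 1 - G.rootStep : ℕ) : ℝ))) *
      treeWt (fun b => Real.exp (κ₁ * (D : ℝ)) * ρ b) η (M * Real.exp (-κ₁)) st G := by
  have h := treeShape_of_mulRawShape hκ hM hW hρ hη hK hsur hy
  have hT : 0 ≤ treeWt ρ η (M * Real.exp (-κ₁)) st G := by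
    rw [treeWt_eq]
    exact mul_nonneg (mul_nonneg hρ (pow_nonneg (mul_nonneg hM (Real.exp_pos _).le) _))
      (npNR_nonneg (fun e => (hη e).le) G)
  calc y ≤ Real.exp (-(κ₁ * ((K - D + 1 - G.rootStep : ℕ) : ℝ))) * treeWt ρ η (M * Real.exp (-κ₁)) st G := h
    _ ≤ Real.exp (κ₁ * (D : ℝ)) * Real.exp (-(κ₁ * ((K + 1 - G.rootStep : ℕ) : ℝ))) *
          treeWt ρ η (M * Real.exp (-κ₁)) st G :=
        mul_le_mul_of_nonneg_right (exp_horizonSpan_le hκ K D G.rootStep) hT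
    _ = Real.exp (-(κ₁ * ((K + 1 - G.rootStep : ℕ) : ℝ))) *
          treeWt (fun b => Real.exp (κ₁ * (D : ℝ)) * ρ b) η (M * Real.exp (-κ₁)) st G := by
        rw [treeWt_const_mul]; ring

/-- SANITY / TIGHTNESS: with no un-healed window (`D = 0`, print's schedule) the horizon bridge is the bridge — same
pending clause (`K − 0 = K`), deficit factor `e^{0} = 1`. [folklore] -/
theorem horizonFactor_zero (κ₁ : ℝ) : Real.exp (κ₁ * ((0 : ℕ) : ℝ)) = 1 := by
  simp

end Bridge

/-! ## §3 The tagged seam with horizon: one genealogy, one branching slot -/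

section SeamH

variable {ε : Type*} [DecidableEq ε] {sh : ε → PEv} {C : T4PrintedShapeBanking.Consts} {K : ℕ} {R : ℕ → ℕ}
  {g : ℕ → ℝ}

/-- **THE SEAM UNDER [CONV-D], ONE TAGGED GENEALOGY** — `T4TaggedShapeBanking.treeShape_of_labelBT` with the pending
clause `K − D < reach` and a displayed price-side allowance `Δ ≥ 1`: if the tagged shapes inhabit `Banking` at cutoff `K`
along `(R, g)`, `0 ≤ C.κ₁`, `0 ≤ Λ′`, then a price `y` that is either `≤ 0` or at most `Δ·Λ′^{partnerAges}` × the raw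
factor of a CONSISTENT, well-formed tagged genealogy `G` with `K − D < reach` obeys
`y ≤ e^{−C.κ₁ (K + 1 − rootStep G)}·treeWt (rhoH (Δ·e^{C.κ₁ D}) C g ∘ sh) (eta C ∘ sh) (Λ′e^{−C.κ₁}) (PEv.step ∘ sh) G`.
`rawFactor_le_shapeT` + `partnerAges_le_windowSurplusT` + the horizon bridge, all by name; `Banking` itself reads no
schedule. [folklore] -/
theorem treeShape_of_labelBT_horizon (hκ : 0 ≤ C.κ₁)
    (hBk : Banking (ConsistentT sh C K R) (dictWT sh R C.n₁) (costT sh C K R) (credit C g ∘ sh)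
      (fun e => C.κ₁ * ((dictWT sh R C.n₁ e : ℕ) : ℝ) + Emarg C (sh e)) (reserve C g ∘ sh) (extnT sh C K R))
    {Λ' Δ : ℝ} (hΛ0 : 0 ≤ Λ') (hΔ : 1 ≤ Δ) (D : ℕ) {y : ℝ} {G : Gen ε}
    (hlab : y ≤ 0 ∨ (ConsistentT sh C K R G ∧ G.WF (dictWT sh R C.n₁) ∧ K - D < G.reach (dictWT sh R C.n₁) ∧
      y ≤ Δ * (Λ' ^ partnerAges (PEv.step ∘ sh) G *
        (Real.exp (-credits (credit C g ∘ sh) G) * Real.exp (lifeCost (dictWT sh R C.n₁) (costT sh C K R) G))))) :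
    y ≤ Real.exp (-(C.κ₁ * ((K + 1 - G.rootStep : ℕ) : ℝ))) *
      treeWt (rhoH (Δ * Real.exp (C.κ₁ * (D : ℝ))) C g ∘ sh) (eta C ∘ sh) (Λ' * Real.exp (-C.κ₁))
        (PEv.step ∘ sh) G := by
  have hΔ0 : 0 ≤ Δ := zero_le_one.trans hΔ
  have hΞ0 : 0 ≤ Δ * Real.exp (C.κ₁ * (D : ℝ)) := mul_nonneg hΔ0 (Real.exp_pos _).le
  rcases hlab with h | ⟨hc, hW, hK, hy⟩
  · exact h.trans (mul_nonneg (Real.exp_pos _).le (treeWt_nonneg (fun b => rhoH_nonneg hΞ0 C g (sh b))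
      (fun e => (eta_pos C (sh e)).le) (mul_nonneg hΛ0 (Real.exp_pos _).le) (PEv.step ∘ sh) G))
  · have hraw := rawFactor_le_shapeT hBk hc hW
    have hy' : y ≤ Λ' ^ partnerAges (PEv.step ∘ sh) G * ((rhoH Δ C g ∘ sh) G.root *
        Real.exp (-(C.κ₁ * ((dictWT sh R C.n₁ G.root : ℕ) : ℝ))) *
        ∏ e ∈ G.events.erase G.root,
          (Real.exp (-(C.κ₁ * ((dictWT sh R C.n₁ e : ℕ) : ℝ))) * (eta C ∘ sh) e)) := by
      calc y ≤ Δ * (Λ' ^ partnerAges (PEv.step ∘ sh) G *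
            (Real.exp (-credits (credit C g ∘ sh) G) *
              Real.exp (lifeCost (dictWT sh R C.n₁) (costT sh C K R) G))) := hy
        _ ≤ Δ * (Λ' ^ partnerAges (PEv.step ∘ sh) G * ((rho C g ∘ sh) G.root *
            Real.exp (-(C.κ₁ * ((dictWT sh R C.n₁ G.root : ℕ) : ℝ))) *
            ∏ e ∈ G.events.erase G.root,
              (Real.exp (-(C.κ₁ * ((dictWT sh R C.n₁ e : ℕ) : ℝ))) * (eta C ∘ sh) e))) :=
          mul_le_mul_of_nonneg_left (mul_le_mul_of_nonneg_left hraw (pow_nonneg hΛ0 _)) hΔ0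
        _ = _ := by simp only [Function.comp_apply, rhoH_apply]; ring
    have h := treeShape_of_mulRawShape_horizon (ρ := rhoH Δ C g ∘ sh) (η := eta C ∘ sh) (st := PEv.step ∘ sh)
      hκ hΛ0 hW (rhoH_nonneg hΔ0 C g (sh G.root)) (fun e => eta_pos C (sh e)) D hK
      (partnerAges_le_windowSurplusT hc) hy'
    have hfun : (fun b => Real.exp (C.κ₁ * (D : ℝ)) * (rhoH Δ C g ∘ sh) b) =
        rhoH (Δ * Real.exp (C.κ₁ * (D : ℝ))) C g ∘ sh := by
      funext b; simp only [Function.comp_apply, rhoH_apply]; ring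
    rw [hfun] at h
    exact h

/-- **THE SEAM UNDER [CONV-D], ONE BRANCHING SLOT** — the labelling binder `hlabT` at one slot with horizon and
allowance: the price at the branching record `G` (a genealogy term over SHAPES) is either `≤ 0` or at most
`Δ·Λ′^{partnerAges G̃}` × the raw factor of SOME consistent, well-formed TAGGED genealogy `G̃ : Gen ε` with
`K − D < reach G̃` whose shape-relabelling is `G`; then
`y ≤ e^{−C.κ₁ (K + 1 − rootStep G)}·treeWt (rhoH (Δ·e^{C.κ₁ D}) C g) (eta C) (Λ′e^{−C.κ₁}) PEv.step G`. [folklore] -/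
theorem treeShape_of_labelT_horizon (hκ : 0 ≤ C.κ₁)
    (hBk : Banking (ConsistentT sh C K R) (dictWT sh R C.n₁) (costT sh C K R) (credit C g ∘ sh)
      (fun e => C.κ₁ * ((dictWT sh R C.n₁ e : ℕ) : ℝ) + Emarg C (sh e)) (reserve C g ∘ sh) (extnT sh C K R))
    {Λ' Δ : ℝ} (hΛ0 : 0 ≤ Λ') (hΔ : 1 ≤ Δ) (D : ℕ) {y : ℝ} {G : Gen PEv}
    (hlabT : y ≤ 0 ∨ ∃ G' : Gen ε, ConsistentT sh C K R G' ∧ G'.WF (dictWT sh R C.n₁) ∧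
      K - D < G'.reach (dictWT sh R C.n₁) ∧ relabel (shape ∘ sh) G' = G ∧
      y ≤ Δ * (Λ' ^ partnerAges (PEv.step ∘ sh) G' *
        (Real.exp (-credits (credit C g ∘ sh) G') * Real.exp (lifeCost (dictWT sh R C.n₁) (costT sh C K R) G')))) :
    y ≤ Real.exp (-(C.κ₁ * ((K + 1 - G.rootStep : ℕ) : ℝ))) *
      treeWt (rhoH (Δ * Real.exp (C.κ₁ * (D : ℝ))) C g) (eta C) (Λ' * Real.exp (-C.κ₁)) PEv.step G := by
  have hΞ0 : 0 ≤ Δ * Real.exp (C.κ₁ * (D : ℝ)) := mul_nonneg (zero_le_one.trans hΔ) (Real.exp_pos _).le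
  rcases hlabT with h | ⟨G', hc, hW, hK, hG, hy⟩
  · exact h.trans (mul_nonneg (Real.exp_pos _).le (treeWt_nonneg (fun b => rhoH_nonneg hΞ0 C g b)
      (fun e => (eta_pos C e).le) (mul_nonneg hΛ0 (Real.exp_pos _).le) PEv.step G))
  · have h := treeShape_of_labelBT_horizon hκ hBk hΛ0 hΔ D (Or.inr ⟨hc, hW, hK, hy⟩)
    rw [← hG, rootStep_relabel, treeWt_relabel_shapeH]
    exact h

end SeamH

/-! ## §4 End to end with horizon: tagged banking along a family of runs, and over the canonical menus -/

section EndToEndH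

variable {ε γ κ ι : Type*} [DecidableEq ε] [DecidableEq γ] [DecidableEq κ] {l₀ : ℝ} {K₀ : ℕ} {π : ℕ → ι → κ}
  {T : ℕ → Finset ι} {A A' : ℕ → ℝ → ι → ℝ} {Bad' : ℕ → ℝ → Finset κ} {dead dead' : ℕ → ℝ → ι → ℝ}
  {F Rf F' Rf' : ℕ → κ → ℝ} {nlow nup mlow mup : ℕ → ℝ → ℝ} {Cn : ℝ}

/-- **`Banking` OF THE TAGGED SHAPES + PRICES LABELLED WITH HORIZON `D` AND ALLOWANCE `Δ` + THE BRANCHING RECORDS GAS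
⇒ THE WEIGHT SLOT, DEFICITED.**  `T4TaggedShapeBanking.exists_relWeightBound_of_bankingT` VERBATIM except: the
labelling binder `hlabT` asks for `K − D < reach` (not `K < reach`) and allows `y ≤ Δ·(Λ′^{ages}·raw factor)`; the
branching records gas is run (`T4BranchingRecordsGas.exists_relWeightBound_of_regeneration_branchingGasRun` by name) with
the root weights `rhoH (Δ·e^{C.κ₁ D}) C (g K)`, whose menu budget is `Δ·e^{C.κ₁ D}·ρ̄` (`sum_rhoH`); conclusion
`∃ K₁ ≥ K₀, RelWeightBound …` with budget `𝟙·Cn·recordsBudget (Δ·e^{C.κ₁ D}·ρ̄) C.κ₁ V Λ η̄₊ j⋆`.  The age datum, its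
rate and fixed point, the four event budgets and the ROOT RATE `Λ·e^{η̄₊ − C.κ₁} < 1` are untouched. [folklore] -/
theorem exists_relWeightBound_of_bankingT_horizon (sh : ε → PEv) {C : T4PrintedShapeBanking.Consts} (hκ : 0 ≤ C.κ₁)
    (R : ℕ → ℕ → ℕ) (g : ℕ → ℕ → ℝ)
    (hBk : ∀ K, K₀ ≤ K → Banking (ConsistentT sh C K (R K)) (dictWT sh (R K) C.n₁) (costT sh C K (R K))
      (credit C (g K) ∘ sh) (fun e => C.κ₁ * ((dictWT sh (R K) C.n₁ e : ℕ) : ℝ) + Emarg C (sh e))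
      (reserve C (g K) ∘ sh) (extnT sh C K (R K)))
    (Cell : ℕ → ℕ → Finset γ) {V Λ : ℝ} (hV : 0 ≤ V) (hΛ : 0 < Λ)
    (hcell : ∀ K a, ((Cell K a).card : ℝ) ≤ V * Λ ^ a)
    (Lren Lmer Lpart Lroot : ℕ → ℕ → Finset PEv) (Ncap : ℕ → ℕ)
    (hst : ∀ K t, ∀ e ∈ Lmer K t, PEv.step e = t) {ρbar a μ ν ηplus : ℝ}
    (hρbar : ∀ K j, ∑ b ∈ Lroot K j, rho C (g K) b ≤ ρbar) (ha : ∀ K t, ∑ e ∈ Lren K t, eta C e ≤ a)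
    (hμ : ∀ K t, ∑ e ∈ Lmer K t, eta C e ≤ μ) (hν : ∀ K s, ∑ b ∈ Lpart K s, eta C b ≤ ν) (hηplus : 0 ≤ ηplus)
    (hr : Λ * Real.exp (ηplus - C.κ₁) < 1) {Λ' : ℝ} (hΛ0 : 0 ≤ Λ')
    (h1 : Λ' * Real.exp (-C.κ₁) * Real.exp ηplus < 1)
    (hx : (a + μ * ν * (Λ' * Real.exp (-C.κ₁) / (1 - Λ' * Real.exp (-C.κ₁) * Real.exp ηplus))) * Real.exp ηplus ≤
      Real.exp ηplus - 1)
    (jstar : ℕ → ℕ) (hj : ∀ K, jstar K ≤ K) {c : ℝ} (hc : 0 < c)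
    (hfrac : ∀ K : ℕ, c * K ≤ ((K - jstar K : ℕ) : ℝ)) (D : ℕ) {Δ : ℝ} (hΔ : 1 ≤ Δ)
    (y : ℕ → ℕ → γ → Gen PEv → ℝ)
    (hy0 : ∀ K, ∀ j ≤ K, ∀ z ∈ Cell K (K - j), ∀ G ∈ runFam Lren Lmer Lpart Lroot Ncap K j, 0 ≤ y K j z G)
    (hlabT : ∀ K, K₀ ≤ K → ∀ j ≤ K, ∀ z ∈ Cell K (K - j), ∀ G ∈ runFam Lren Lmer Lpart Lroot Ncap K j,
      y K j z G ≤ 0 ∨ ∃ G' : Gen ε, ConsistentT sh C K (R K) G' ∧ G'.WF (dictWT sh (R K) C.n₁) ∧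
        K - D < G'.reach (dictWT sh (R K) C.n₁) ∧ relabel (shape ∘ sh) G' = G ∧
        y K j z G ≤ Δ * (Λ' ^ partnerAges (PEv.step ∘ sh) G' * (Real.exp (-credits (credit C (g K) ∘ sh) G') *
          Real.exp (lifeCost (dictWT sh (R K) C.n₁) (costT sh C K (R K)) G'))))
    (str : ℕ → κ → Finset (BSlot γ PEv))
    (hinj : ∀ K t, |t| ≤ l₀ → K₀ ≤ K → Set.InjOn (str K) (Bad' K t))
    (hstr : ∀ K t, |t| ≤ l₀ → K₀ ≤ K → ∀ c ∈ Bad' K t,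
      str K c ⊆ bliveSlots Cell (runFam Lren Lmer Lpart Lroot Ncap) K ∧
        ∃ o ∈ boldSlots Cell (runFam Lren Lmer Lpart Lroot Ncap) jstar K, o ∈ str K c)
    (hA : Regeneration l₀ π T A Bad' dead F Rf nlow nup Cn K₀)
    (hA' : Regeneration l₀ π T A' Bad' dead' F' Rf' mlow mup Cn K₀)
    (hF : ∀ K t, |t| ≤ l₀ → K₀ ≤ K → ∀ c ∈ Bad' K t, F K c * Rf K c ≤ famWeight (bslotPrice (y K)) (str K c))
    (hF' : ∀ K t, |t| ≤ l₀ → K₀ ≤ K → ∀ c ∈ Bad' K t, F' K c * Rf' K c ≤ famWeight (bslotPrice (y K)) (str K c))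
    (hCn : 0 ≤ Cn) :
    ∃ K₁, K₀ ≤ K₁ ∧ RelWeightBound l₀ T A A' (fun K t => if K₁ ≤ K then badOfClass π T Bad' K t else ∅)
      (Set.indicator {K | K₁ ≤ K}
        (fun K => Cn * recordsBudget (Δ * Real.exp (C.κ₁ * (D : ℝ)) * ρbar) C.κ₁ V Λ ηplus jstar K)) := by
  have hΞ0 : 0 ≤ Δ * Real.exp (C.κ₁ * (D : ℝ)) := mul_nonneg (zero_le_one.trans hΔ) (Real.exp_pos _).le
  exact exists_relWeightBound_of_regeneration_branchingGasRun Cell hV hΛ hcell Lren Lmer Lpart Lroot Ncap PEv.step hst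
    (fun K => rhoH (Δ * Real.exp (C.κ₁ * (D : ℝ))) C (g K)) (fun _ => eta C)
    (fun K b => rhoH_nonneg hΞ0 C (g K) b) (fun _ e => (eta_pos C e).le)
    (fun K j => by
      rw [sum_rhoH]
      exact mul_le_mul_of_nonneg_left (hρbar K j) hΞ0)
    ha hμ hν (mul_nonneg hΛ0 (Real.exp_pos _).le) hηplus h1 hx hr jstar hj hc hfrac y hy0
    (fun K hK j hjK z hz G hG => by
      have h := treeShape_of_labelT_horizon hκ (hBk K hK) hΛ0 hΔ D (hlabT K hK j hjK z hz G hG)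
      rwa [rootStep_of_mem_fam (Lren := Lren K) (Lmer := Lmer K) (Lpart := Lpart K) (Ncap K) (Lroot K j) j K G hG]
        at h)
    str hinj hstr hA hA' hF hF' hCn

/-- **END TO END OVER THE CANONICAL MENUS, UNDER [CONV-D].**  `T4CanonicalMenus.exists_irThreshold_relWeightBound_canon`
VERBATIM except: the labelling binder asks for `K − D < reach` and allows the factor `Δ ≥ 1`, and the conclusion's budget
is `𝟙·Cn·recordsBudget (Δ·e^{C.κ₁ D}·birthMass C) C.κ₁ V Λ η̄₊ j⋆` — the birth mass scaled by the horizon factor and the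
allowance, NOTHING ELSE CHANGED: one infrared threshold `x₀` from the constants (`exists_irThresholdT`), typed (2.7) /
(2.9) / (2.5), `1 ≤ log g⁻²`, `x₀ ≤ log g_{K,K}⁻²` from `K₀` on, nonnegative profile, `0 < C.μ`, the fixed point in the
constants, the age rate, and the CONDITION `Λ·e^{η̄₊ − C.κ₁} < 1`.  `D` is a CONSTANT (`N_W + 1`, `N_W ≤ N₀`): a `D`
growing with `K` would make the factor K-dependent — R-ηW-6, not this theorem. [folklore] -/
theorem exists_irThreshold_relWeightBound_canon_horizon (sh : ε → PEv) (C : T4PrintedShapeBanking.Consts)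
    (hC : C.Valid) (ha₀ : 0 < C.a) (hA₀ : 0 < C.A₀) (hμ₀ : 0 < C.μ) {L r : ℕ} (hL : 1 ≤ L) {β₀ : ℝ} (hβ : 0 ≤ β₀)
    (hrq : r * (C.q' + 1) < C.p₀)
    (Cell : ℕ → ℕ → Finset γ) {V Λ : ℝ} (hV : 0 ≤ V) (hΛ : 0 < Λ)
    (hcell : ∀ K a, ((Cell K a).card : ℝ) ≤ V * Λ ^ a) (Dcap Ncap : ℕ → ℕ)
    (jstar : ℕ → ℕ) (hj : ∀ K, jstar K ≤ K) {c : ℝ} (hc : 0 < c)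
    (hfrac : ∀ K : ℕ, c * K ≤ ((K - jstar K : ℕ) : ℝ)) (D : ℕ) {Δ : ℝ} (hΔ : 1 ≤ Δ)
    (hA : Regeneration l₀ π T A Bad' dead F Rf nlow nup Cn K₀)
    (hA' : Regeneration l₀ π T A' Bad' dead' F' Rf' mlow mup Cn K₀) (hCn : 0 ≤ Cn) :
    ∃ x₀ : ℝ, ∀ (R : ℕ → ℕ → ℕ) (g : ℕ → ℕ → ℝ) (β' : ℕ → ℝ),
      (∀ K, K₀ ≤ K → B14.FlowIneq27 (g K) (β' K) β₀ C.p₀ K) →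
      (∀ K, K₀ ≤ K → B14FlowStep.FlowIneq29 (R K) (g K) L (β' K) β₀ K) →
      (∀ K, K₀ ≤ K → ∀ s, s ≤ K → B14.IsRj L r (g K s) (R K s)) →
      (∀ K, K₀ ≤ K → ∀ s, s ≤ K → 1 ≤ Real.log ((g K s) ^ 2)⁻¹) →
      (∀ K, K₀ ≤ K → x₀ ≤ Real.log ((g K K) ^ 2)⁻¹) →
      (∀ K s, 0 ≤ p0Profile C.A₀ C.p₀ (g K s)) →
      ∀ {ηplus : ℝ}, 0 ≤ ηplus → Λ * Real.exp (ηplus - C.κ₁) < 1 →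
      ∀ {Λ' : ℝ}, 0 ≤ Λ' → Λ' * Real.exp (-C.κ₁) * Real.exp ηplus < 1 →
      (Real.exp (-C.E₀) + Real.exp (-C.E₀) * birthMass C *
          (Λ' * Real.exp (-C.κ₁) / (1 - Λ' * Real.exp (-C.κ₁) * Real.exp ηplus))) * Real.exp ηplus ≤
        Real.exp ηplus - 1 →
      ∀ (y : ℕ → ℕ → γ → Gen PEv → ℝ),
      (∀ K, ∀ j ≤ K, ∀ z ∈ Cell K (K - j), ∀ G ∈ canonFam Dcap Ncap K j, 0 ≤ y K j z G) →
      (∀ K, K₀ ≤ K → ∀ j ≤ K, ∀ z ∈ Cell K (K - j), ∀ G ∈ canonFam Dcap Ncap K j,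
        y K j z G ≤ 0 ∨ ∃ G' : Gen ε, ConsistentT sh C K (R K) G' ∧ G'.WF (dictWT sh (R K) C.n₁) ∧
          K - D < G'.reach (dictWT sh (R K) C.n₁) ∧ relabel (shape ∘ sh) G' = G ∧
          y K j z G ≤ Δ * (Λ' ^ partnerAges (PEv.step ∘ sh) G' * (Real.exp (-credits (credit C (g K) ∘ sh) G') *
            Real.exp (lifeCost (dictWT sh (R K) C.n₁) (costT sh C K (R K)) G')))) →
      ∀ (str : ℕ → κ → Finset (BSlot γ PEv)),
      (∀ K t, |t| ≤ l₀ → K₀ ≤ K → Set.InjOn (str K) (Bad' K t)) →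
      (∀ K t, |t| ≤ l₀ → K₀ ≤ K → ∀ c ∈ Bad' K t,
        str K c ⊆ bliveSlots Cell (canonFam Dcap Ncap) K ∧
          ∃ o ∈ boldSlots Cell (canonFam Dcap Ncap) jstar K, o ∈ str K c) →
      (∀ K t, |t| ≤ l₀ → K₀ ≤ K → ∀ c ∈ Bad' K t, F K c * Rf K c ≤ famWeight (bslotPrice (y K)) (str K c)) →
      (∀ K t, |t| ≤ l₀ → K₀ ≤ K → ∀ c ∈ Bad' K t, F' K c * Rf' K c ≤ famWeight (bslotPrice (y K)) (str K c)) →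
      ∃ K₁, K₀ ≤ K₁ ∧ RelWeightBound l₀ T A A' (fun K t => if K₁ ≤ K then badOfClass π T Bad' K t else ∅)
        (Set.indicator {K | K₁ ≤ K}
          (fun K => Cn * recordsBudget (Δ * Real.exp (C.κ₁ * (D : ℝ)) * birthMass C) C.κ₁ V Λ ηplus jstar K)) := by
  obtain ⟨x₀, hx₀⟩ := exists_irThresholdT sh C hC ha₀ hA₀ hL hβ hrq
  refine ⟨x₀, ?_⟩
  intro R g β' h27 h29 hR hx1 hir hP ηplus hηplus hr Λ' hΛ0 h1 hx y hy0 hlabT str hinj hstr hF hF'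
  exact exists_relWeightBound_of_bankingT_horizon sh hC.κ₁_nonneg R g
    (fun K hK => hx₀ K (R K) (g K) (β' K) (h27 K hK) (h29 K hK) (hR K hK) (hx1 K hK) (hir K hK))
    Cell hV hΛ hcell (fun _ => menuRen) (fun _ => menuMer) (dictB Dcap) (dictB Dcap) Ncap (fun _ t => menuMer_step t)
    (fun K j => sum_dictB_rho_le hμ₀ Dcap K j (hP K j)) (fun K t => (sum_menuRen_eta C t).le)
    (fun K t => (sum_menuMer_eta C t).le) (fun K s => sum_dictB_eta_le hμ₀ Dcap K s) hηplus hr hΛ0 h1 hx jstar hj hc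
    hfrac D hΔ y hy0 hlabT str hinj hstr hA hA' hF hF' hCn

end EndToEndH

/-! ## §5 SMALL and K-free: the deficited records budget is a constant times the budget; explicit threshold -/

section Small

/-- **THE DEFICIT IS A K-FREE CONSTANT FACTOR ON THE BUDGET**: `recordsBudget (Ξρ̄) = Ξ·exp((Ξ − 1)·m)·recordsBudget ρ̄`
with the live mass `m = ρ̄e^{−κ₁}V/(1 − Λe^{η̄ − κ₁})` — the old mass scales by `Ξ`, the live-mass exponential by
`exp((Ξ − 1)m)`; neither depends on `K`. [folklore] -/
theorem recordsBudget_const_mul (Ξ ρbar κ₁ V Λ ηbar : ℝ) (jstar : ℕ → ℕ) (K : ℕ) :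
    recordsBudget (Ξ * ρbar) κ₁ V Λ ηbar jstar K =
      Ξ * Real.exp ((Ξ - 1) * (ρbar * Real.exp (-κ₁) * V * (1 / (1 - Λ * Real.exp (ηbar - κ₁))))) *
        recordsBudget ρbar κ₁ V Λ ηbar jstar K := by
  simp only [recordsBudget]
  have h : Real.exp (Ξ * ρbar * Real.exp (-κ₁) * V * (1 / (1 - Λ * Real.exp (ηbar - κ₁)))) =
      Real.exp ((Ξ - 1) * (ρbar * Real.exp (-κ₁) * V * (1 / (1 - Λ * Real.exp (ηbar - κ₁))))) *
        Real.exp (ρbar * Real.exp (-κ₁) * V * (1 / (1 - Λ * Real.exp (ηbar - κ₁)))) := by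
    rw [← Real.exp_add]
    congr 1
    ring
  rw [h]
  ring

/-- SANITY: no deficit, no factor (`Ξ = 1`). [folklore] -/
theorem recordsBudget_const_mul_one (ρbar κ₁ V Λ ηbar : ℝ) (jstar : ℕ → ℕ) (K : ℕ) :
    recordsBudget (1 * ρbar) κ₁ V Λ ηbar jstar K = recordsBudget ρbar κ₁ V Λ ηbar jstar K := by
  rw [one_mul]

/-- **THE RECORDS BUDGET IS GEOMETRIC IN `K`** when a fraction `c` of the steps is old (`c·K ≤ K − j⋆(K)`):
`recordsBudget ρ̄ κ₁ V Λ η̄ j⋆ K ≤ M·ϱ^K` with `M = ρ̄e^{−κ₁}V·r/(1 − r)·exp(ρ̄e^{−κ₁}V/(1 − r))`, `r = Λe^{η̄ − κ₁}`,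
`ϱ = r^c` — `T4OverdueHorizon.twoRateBudget_le_geometric` (renewal member, by name) times the live-mass exponential.
[folklore] -/
theorem recordsBudget_le_geometric {ρbar κ₁ V Λ ηbar c : ℝ} (hρbar : 0 ≤ ρbar) (hV : 0 ≤ V) (hΛ : 0 < Λ)
    (hr : Λ * Real.exp (ηbar - κ₁) < 1) {jstar : ℕ → ℕ} (hfrac : ∀ K : ℕ, c * K ≤ ((K - jstar K : ℕ) : ℝ))
    (K : ℕ) :
    recordsBudget ρbar κ₁ V Λ ηbar jstar K ≤
      ρbar * Real.exp (-κ₁) * V * (Λ * Real.exp (ηbar - κ₁)) / (1 - Λ * Real.exp (ηbar - κ₁)) *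
        Real.exp (ρbar * Real.exp (-κ₁) * V * (1 / (1 - Λ * Real.exp (ηbar - κ₁)))) *
        ((Λ * Real.exp (ηbar - κ₁)) ^ c) ^ K := by
  have h0 : 0 < Λ * Real.exp (ηbar - κ₁) := mul_pos hΛ (Real.exp_pos _)
  have hg := T4OverdueHorizon.twoRateBudget_le_geometric (mul_nonneg hρbar (Real.exp_pos (-κ₁)).le) hV h0 hr hfrac K
  unfold recordsBudget
  calc ρbar * Real.exp (-κ₁) * V *
        ((Λ * Real.exp (ηbar - κ₁)) ^ (K - jstar K + 1) / (1 - Λ * Real.exp (ηbar - κ₁))) *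
        Real.exp (ρbar * Real.exp (-κ₁) * V * (1 / (1 - Λ * Real.exp (ηbar - κ₁))))
      ≤ ρbar * Real.exp (-κ₁) * V * (Λ * Real.exp (ηbar - κ₁)) / (1 - Λ * Real.exp (ηbar - κ₁)) *
          ((Λ * Real.exp (ηbar - κ₁)) ^ c) ^ K *
          Real.exp (ρbar * Real.exp (-κ₁) * V * (1 / (1 - Λ * Real.exp (ηbar - κ₁)))) :=
        mul_le_mul_of_nonneg_right hg (Real.exp_pos _).le
    _ = _ := by ring

/-- **THE COUNT'S WEIGHT IS SMALL, WITH A K-FREE THRESHOLD (O-ηW-β: «W_K must stay SMALL and K-free»).**  With `M` and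
`ϱ` as in `recordsBudget_le_geometric` and `Cn > 0`: `Cn·recordsBudget ρ̄ κ₁ V Λ η̄ j⋆ K < ε` for EVERY `K` with
`log(Cn·M/ε) < K·log ϱ⁻¹` (`T4OverdueHorizon.mul_pow_lt_of_log_lt` by name).  Every letter on the left is K-free when
`Cn, ρ̄, κ₁, V, Λ, η̄, c, ε` are — at the deficited mass `ρ̄ ↦ Δ·e^{κ₁ D}·ρ̄` included (`log_horizonConst`); the steps
below the threshold go to `T4WeightBudget.relWeightBound_of_eventually` exactly as before. [folklore] -/
theorem recordsWeight_lt {Cn ρbar κ₁ V Λ ηbar c ε : ℝ} (hCn : 0 < Cn) (hρbar : 0 < ρbar) (hV : 0 < V) (hΛ : 0 < Λ)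
    (hr : Λ * Real.exp (ηbar - κ₁) < 1) (hε : 0 < ε) {jstar : ℕ → ℕ}
    (hfrac : ∀ K : ℕ, c * K ≤ ((K - jstar K : ℕ) : ℝ)) {K : ℕ}
    (hK : Real.log (Cn * (ρbar * Real.exp (-κ₁) * V * (Λ * Real.exp (ηbar - κ₁)) / (1 - Λ * Real.exp (ηbar - κ₁)) *
        Real.exp (ρbar * Real.exp (-κ₁) * V * (1 / (1 - Λ * Real.exp (ηbar - κ₁))))) / ε) <
      K * Real.log ((Λ * Real.exp (ηbar - κ₁)) ^ c)⁻¹) :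
    Cn * recordsBudget ρbar κ₁ V Λ ηbar jstar K < ε := by
  have h0 : 0 < Λ * Real.exp (ηbar - κ₁) := mul_pos hΛ (Real.exp_pos _)
  have h1r : 0 < 1 - Λ * Real.exp (ηbar - κ₁) := by linarith
  have hM : 0 < ρbar * Real.exp (-κ₁) * V * (Λ * Real.exp (ηbar - κ₁)) / (1 - Λ * Real.exp (ηbar - κ₁)) *
      Real.exp (ρbar * Real.exp (-κ₁) * V * (1 / (1 - Λ * Real.exp (ηbar - κ₁)))) :=
    mul_pos (div_pos (mul_pos (mul_pos (mul_pos hρbar (Real.exp_pos _)) hV) h0) h1r) (Real.exp_pos _)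
  have hϱ : 0 < (Λ * Real.exp (ηbar - κ₁)) ^ c := Real.rpow_pos_of_pos h0 c
  calc Cn * recordsBudget ρbar κ₁ V Λ ηbar jstar K
      ≤ Cn * (ρbar * Real.exp (-κ₁) * V * (Λ * Real.exp (ηbar - κ₁)) / (1 - Λ * Real.exp (ηbar - κ₁)) *
          Real.exp (ρbar * Real.exp (-κ₁) * V * (1 / (1 - Λ * Real.exp (ηbar - κ₁)))) *
          ((Λ * Real.exp (ηbar - κ₁)) ^ c) ^ K) :=
        mul_le_mul_of_nonneg_left (recordsBudget_le_geometric hρbar.le hV.le hΛ hr hfrac K) hCn.le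
    _ = Cn * (ρbar * Real.exp (-κ₁) * V * (Λ * Real.exp (ηbar - κ₁)) / (1 - Λ * Real.exp (ηbar - κ₁)) *
          Real.exp (ρbar * Real.exp (-κ₁) * V * (1 / (1 - Λ * Real.exp (ηbar - κ₁))))) *
          ((Λ * Real.exp (ηbar - κ₁)) ^ c) ^ K := by ring
    _ < ε := T4OverdueHorizon.mul_pow_lt_of_log_lt (mul_pos hCn hM) hϱ hε hK

/-- **THE THRESHOLD SHIFT IS K-FREE AND EXPLICIT**: at the deficited mass `Ξρ̄` the constant `M` of
`recordsBudget_le_geometric` is `Ξ·exp((Ξ − 1)·m)·M` (`m` the live mass), so its logarithm moves by `log Ξ + (Ξ − 1)·m` —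
with `Ξ = Δ·e^{κ₁ D}`: by `log Δ + κ₁·D + (Δe^{κ₁ D} − 1)·m`, and by nothing that depends on `K`. [folklore] -/
theorem log_horizonConst {Ξ M m : ℝ} (hΞ : 0 < Ξ) (hM : 0 < M) :
    Real.log (Ξ * Real.exp ((Ξ - 1) * m) * M) = Real.log M + (Real.log Ξ + (Ξ - 1) * m) := by
  rw [Real.log_mul (mul_pos hΞ (Real.exp_pos _)).ne' hM.ne', Real.log_mul hΞ.ne' (Real.exp_pos _).ne',
    Real.log_exp]
  ring

/-- the horizon factor's logarithm: `log (Δ·e^{κ₁ D}) = log Δ + κ₁·D` (`Δ > 0`). [folklore] -/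
theorem log_horizonFactor {Δ : ℝ} (hΔ : 0 < Δ) (κ₁ : ℝ) (D : ℕ) :
    Real.log (Δ * Real.exp (κ₁ * (D : ℝ))) = Real.log Δ + κ₁ * (D : ℝ) := by
  rw [Real.log_mul hΔ.ne' (Real.exp_pos _).ne', Real.log_exp]

/-- the horizon factor is at least `1` (`Δ ≥ 1`, `κ₁ ≥ 0`): the deficited budget dominates the undeficited one — a deeper
un-healed window or a larger allowance only costs more. [folklore] -/
theorem one_le_horizonFactor {Δ κ₁ : ℝ} (hΔ : 1 ≤ Δ) (hκ : 0 ≤ κ₁) (D : ℕ) :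
    1 ≤ Δ * Real.exp (κ₁ * (D : ℝ)) :=
  one_le_mul_of_one_le_of_one_le hΔ (Real.one_le_exp (mul_nonneg hκ (Nat.cast_nonneg D)))

/-- … and monotone in the window depth. [folklore] -/
theorem horizonFactor_mono {Δ κ₁ : ℝ} (hΔ : 0 ≤ Δ) (hκ : 0 ≤ κ₁) {D D' : ℕ} (h : D ≤ D') :
    Δ * Real.exp (κ₁ * (D : ℝ)) ≤ Δ * Real.exp (κ₁ * (D' : ℝ)) :=
  mul_le_mul_of_nonneg_left (Real.exp_le_exp.2 (mul_le_mul_of_nonneg_left (Nat.cast_le.2 h) hκ)) hΔ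

end Small

/-! ## §6 Sanity: `D = 0`, `Δ = 1` is `_canon` verbatim on the weight side; a decided deficit -/

section Sanity

/-- no window, no allowance: the deficited root weight IS the model's root weight. [folklore] -/
theorem rhoH_canon (C : T4PrintedShapeBanking.Consts) (g : ℕ → ℝ) :
    rhoH (1 * Real.exp (C.κ₁ * ((0 : ℕ) : ℝ))) C g = rho C g := by
  funext b; simp

/-- no window, no allowance: the deficited birth mass IS `birthMass C`, so the budget of
`exists_irThreshold_relWeightBound_canon_horizon` at `D = 0`, `Δ = 1` is `_canon`'s budget verbatim. [folklore] -/
theorem horizonMass_zero (C : T4PrintedShapeBanking.Consts) :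
    1 * Real.exp (C.κ₁ * ((0 : ℕ) : ℝ)) * birthMass C = birthMass C := by
  simp

/-- the pending clause at `D = 0` is the undeficited one: `K − 0 < reach ↔ K < reach`. [folklore] -/
theorem pendingClause_zero (K reach : ℕ) : K - 0 < reach ↔ K < reach := by
  rw [Nat.sub_zero]

/-- the horizon clause is WEAKER than the pending clause (`K − D ≤ K`): every genealogy the undeficited binder accepts,
the deficited binder accepts. [folklore] -/
theorem pendingClause_of_pending {K reach : ℕ} (D : ℕ) (h : K < reach) : K - D < reach :=
  lt_of_le_of_lt (Nat.sub_le K D) h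

/-- DECIDED DEFICIT: per-step window credit `κ₁ = log 2`, window depth `D = 3` (`N_W = 2`) ⇒ factor `e^{κ₁ D} = 8`.
[folklore] -/
theorem horizonFactor_log2_three : Real.exp (Real.log 2 * ((3 : ℕ) : ℝ)) = 8 := by
  rw [mul_comm, ← Real.log_rpow (by norm_num : (0 : ℝ) < 2), Real.exp_log (Real.rpow_pos_of_pos (by norm_num) _),
    Real.rpow_natCast]
  norm_num

end Sanity

end

end T4CountHorizon

end Literature.MathematicalPhysics.QuantumFieldTheory.Balaban1983to89
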